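import Summits.AnomalousDissipation.AnomalousDissipation.Theorems.BaireTransferDenseLoudDesignerForcesErgodicClosing

/-!
# The periodic-chart-encoding predicate is EQUIVALENT to the closing property (line `ergodic-budget-selection-closing`,
# crux `BaireTransfer.DenseLoudDesignerForces`, stmt-AnomalousDissipation-1143) — Stub E of skeleton v8.1/v9

Sorry-free discharge of the registered stub `stub_encodingOfClosing` (fourth lead c3-0; found and proved by the lead's Stub-2′ worker,
2026-08-16): `HasKatokClosing K φ μ → HasPeriodicChartEncoding K φ μ` by a FAKE encoding that carries no hyperbolic information —
`A_k = ½·id` (everything stable, `P_k = id`, `B_k = 0`), `ψ_k v = ½ v + e·[n ∣ k+1]` with one jump vector `e` of norm `d` per period; its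
unique `n`-periodic trajectory has `∑_{k<n} ‖v_k‖ ≥ ⅔‖e‖`, so the decode clause with `C = 2` is exactly the closing conclusion at accuracy
`η = d`.  Together with the landed `hasKatokClosing_of_encoding` (`…ErgodicClosing.lean`, p103311) this shows
`HasPeriodicChartEncoding K φ μ ↔ HasKatokClosing K φ μ` (`hasPeriodicChartEncoding_iff_hasKatokClosing`): the v5 Stub 2′
`stub_chartEncoding` is EQUIVALENT to Stub 2 `stub_closingLemma` (enlarged-phase form) — the v5 reshaping moved no content into the landed
shadowing kernel, and skeleton v9 re-decomposes Stub 2 along the Navier–Stokes / smooth-ergodic seam instead (stubs N, D, G).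
The gadgets `fakeA`, `fakeP`, `fakeB`, `fakeJump`, `fakeψ` are proof devices of this file only.

References: A. Katok, Publ. Math. IHÉS 51 (1980) §3 (Main Lemma); S. Yu. Pilyugin, LNM 1706 (1999) §1.3.
-/

set_option linter.dupNamespace false

noncomputable section

open scoped BigOperators Topology ENNReal
open Filter Set Function MeasureTheory

namespace Summit.AnomalousDissipation.AnomalousDissipation.Theorems.DenseLoudDesignerForces.Ergodic

open Literature.Analysis.FunctionSpaces Literature.Analysis.FunctionSpaces.Torus
open Literature.Analysis.FluidPDE Literature.Analysis.FluidPDE.Torus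
open Literature.Dynamics.Hyperbolic
open Summit.AnomalousDissipation.AnomalousDissipation.Theorems.DenseLoudDesignerForces.Negative

section Fake

variable {E : Type*} [NormedAddCommGroup E] [NormedSpace ℝ E]

/-- The fake linear parts `A_k = ½·id`. [folklore] -/
def fakeA : ℤ → E →L[ℝ] E := fun _ => (1 / 2 : ℝ) • (1 : E →L[ℝ] E)

/-- The fake projectors `P_k = id` (everything is stable). [folklore] -/
def fakeP : ℤ → E →L[ℝ] E := fun _ => 1

/-- The fake right inverses `B_k = 0`. [folklore] -/
def fakeB : ℤ → E →L[ℝ] E := fun _ => 0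

/-- The jump sequence: `e` at the indices `k ≡ -1 (mod n)`, `0` elsewhere. [folklore] -/
def fakeJump (n : ℕ) (e : E) (k : ℤ) : E := by
  classical
  exact if (n : ℤ) ∣ k + 1 then e else 0

/-- The fake chart maps `ψ_k v = ½ v + jump_k`. [folklore] -/
def fakeψ (n : ℕ) (e : E) (k : ℤ) (v : E) : E := (1 / 2 : ℝ) • v + fakeJump n e k

omit [NormedSpace ℝ E] in
/-- The jump vectors have norm `≤ d`. [folklore] -/
theorem fakeJump_norm_le {n : ℕ} {e : E} {d : ℝ} (he : ‖e‖ ≤ d) (k : ℤ) : ‖fakeJump n e k‖ ≤ d := by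
  classical
  unfold fakeJump
  split_ifs
  · exact he
  · simpa using (norm_nonneg e).trans he

/-- `A_k v = ½ v`. [folklore] -/
theorem fakeA_apply (k : ℤ) (v : E) : fakeA k v = (1 / 2 : ℝ) • v := by
  simp [fakeA]

/-- `P_k v = v`. [folklore] -/
theorem fakeP_apply (k : ℤ) (v : E) : fakeP k v = v := by simp [fakeP]

/-- `B_k v = 0`. [folklore] -/
theorem fakeB_apply (k : ℤ) (v : E) : fakeB k v = 0 := by simp [fakeB]

/-- The unstable spaces of the fake projectors are trivial. [folklore] -/
theorem eq_zero_of_mem_unstable_fakeP {k : ℤ} {v : E} (hv : v ∈ unstableSpace (fakeP (E := E)) k) : v = 0 := by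
  obtain ⟨w, hw⟩ := mem_unstableSpace.1 hv
  rw [← hw]
  simp [fakeP]

/-- Every vector is stable for the fake projectors. [folklore] -/
theorem mem_stable_fakeP (k : ℤ) (v : E) : v ∈ stableSpace (fakeP (E := E)) k :=
  mem_stableSpace.2 ⟨v, fakeP_apply k v⟩

/-- The fake data form a `(½, 1)`-hyperbolic sequence. [folklore] -/
theorem fake_isHyperbolicSequence : IsHyperbolicSequence (fakeA (E := E)) fakeP fakeB (1 / 2) 1 where
  lam_pos := by norm_num
  lam_lt_one := by norm_num
  one_le_N := le_rfl
  proj_idem k v := by simp [fakeP]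
  norm_P_le k := by
    have h := ContinuousLinearMap.norm_id_le (𝕜 := ℝ) (E := E)
    simpa [fakeP, ContinuousLinearMap.one_def] using h
  norm_Q_le k := by simp [fakeP]
  mapsTo_stable k v _ := mem_stable_fakeP (k + 1) (fakeA k v)
  contract k v _ := by
    rw [fakeA_apply, norm_smul]
    norm_num
  mapsTo_unstable k v _ := by
    rw [fakeB_apply]
    exact Submodule.zero_mem _
  inv_contract k v _ := by
    rw [fakeB_apply, norm_zero]
    positivity
  rightInverse k v hv := by
    rw [eq_zero_of_mem_unstable_fakeP hv, fakeB_apply, map_zero]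

/-- The nonlinearity of the fake maps is the jump, constant in `v`. [folklore] -/
theorem fakeψ_sub_fakeA (n : ℕ) (e : E) (k : ℤ) (v : E) : fakeψ n e k v - fakeA k v = fakeJump n e k := by
  rw [fakeA_apply]; simp [fakeψ]

/-- The fake maps are `n`-periodic in `k`. [folklore] -/
theorem fakeψ_periodic (n : ℕ) (e : E) (k : ℤ) : fakeψ n e (k + n) = fakeψ n e k := by
  classical
  funext v
  have hiff : ((n : ℤ) ∣ k + n + 1) ↔ ((n : ℤ) ∣ k + 1) := by
    rw [show k + (n : ℤ) + 1 = (k + 1) + n by ring]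
    exact dvd_add_self_right
  simp only [fakeψ, fakeJump, hiff]

omit [NormedSpace ℝ E] in
/-- No jump at the indices `k < n`, `k ≠ n - 1`. [folklore] -/
theorem fakeJump_natCast_eq_zero {n k : ℕ} (hk : k < n) (hkn : k ≠ n - 1) (e : E) : fakeJump n e k = 0 := by
  classical
  have hndvd : ¬ ((n : ℤ) ∣ (k : ℤ) + 1) := by
    intro hdvd
    have h1 : (n : ℤ) ≤ (k : ℤ) + 1 := Int.le_of_dvd (by positivity) hdvd
    omega
  simp [fakeJump, hndvd]

omit [NormedSpace ℝ E] in
/-- The jump sits at index `n - 1`. [folklore] -/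
theorem fakeJump_pred (n : ℕ) (e : E) : fakeJump n e ((n : ℤ) - 1) = e := by
  classical
  simp [fakeJump]

/-- The summed pseudo-orbit error over a period is `≤ d`. [folklore] -/
theorem sum_norm_fakeψ_zero_le {n : ℕ} (hn : 0 < n) {e : E} {d : ℝ} (he : ‖e‖ ≤ d) :
    ∑ k ∈ Finset.range n, ‖fakeψ n e k 0‖ ≤ d := by
  have hd : 0 ≤ d := (norm_nonneg e).trans he
  have hterm : ∀ k ∈ Finset.range n, ‖fakeψ n e k 0‖ ≤ if k = n - 1 then d else 0 := by
    intro k hk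
    have hk' : k < n := Finset.mem_range.1 hk
    have hψ0 : fakeψ n e k 0 = fakeJump n e k := by simp [fakeψ]
    rw [hψ0]
    by_cases hkn : k = n - 1
    · rw [if_pos hkn]; exact fakeJump_norm_le he k
    · rw [if_neg hkn, fakeJump_natCast_eq_zero hk' hkn e, norm_zero]
  calc ∑ k ∈ Finset.range n, ‖fakeψ n e k 0‖ ≤ ∑ k ∈ Finset.range n, (if k = n - 1 then d else 0) :=
        Finset.sum_le_sum hterm
    _ = d := by
        rw [Finset.sum_ite_eq', if_pos (Finset.mem_range.2 (Nat.sub_lt hn one_pos))]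

/-- A periodic trajectory of the fake maps sees the jump: `‖e‖ ≤ ‖v₀‖ + ½‖v_{n-1}‖ ≤ (3/2) ∑_{k<n} ‖v_k‖`. [folklore] -/
theorem norm_jump_le_of_trajectory {n : ℕ} (hn : 0 < n) {e : E} {v : ℤ → E}
    (htraj : ∀ k, fakeψ n e k (v k) = v (k + 1)) (hvper : ∀ k : ℤ, v (k + n) = v k) :
    ‖e‖ ≤ (3 / 2) * ∑ k ∈ Finset.range n, ‖v k‖ := by
  have hstep : (1 / 2 : ℝ) • v ((n : ℤ) - 1) + e = v 0 := by
    have h1 := htraj ((n : ℤ) - 1)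
    have h2 := hvper 0
    rw [zero_add] at h2
    rw [sub_add_cancel, h2] at h1
    simpa [fakeψ, fakeJump_pred] using h1
  have hev : e = v 0 - (1 / 2 : ℝ) • v ((n : ℤ) - 1) := by
    rw [← hstep]; abel
  have h0 : ‖v 0‖ ≤ ∑ k ∈ Finset.range n, ‖v k‖ := by
    have := Finset.single_le_sum (f := fun k : ℕ => ‖v k‖) (fun _ _ => norm_nonneg _)
      (Finset.mem_range.2 hn)
    simpa using this
  have h1 : ‖v ((n : ℤ) - 1)‖ ≤ ∑ k ∈ Finset.range n, ‖v k‖ := by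
    have := Finset.single_le_sum (f := fun k : ℕ => ‖v k‖) (fun _ _ => norm_nonneg _)
      (Finset.mem_range.2 (Nat.sub_lt hn one_pos))
    simpa [Nat.cast_pred hn] using this
  have : ‖e‖ ≤ ‖v 0‖ + (1 / 2 : ℝ) * ‖v ((n : ℤ) - 1)‖ := by
    rw [hev]
    refine (norm_sub_le _ _).trans ?_
    rw [norm_smul]
    norm_num
  nlinarith [norm_nonneg (v ((n : ℤ) - 1)), norm_nonneg (v 0)]

end Fake

/-- **The closing property implies the registered periodic chart encoding** (fake encoding: `A = ½·id`,
`P = id`, `B = 0`, one jump of size `d` per period; decode constant `C = 2`). [folklore] -/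
theorem hasPeriodicChartEncoding_of_hasKatokClosing {K : Set Hsp} {φ : ℝ → Hsp → Hsp} {μ : Measure Hsp}
    (h : HasKatokClosing K φ μ) : HasPeriodicChartEncoding K φ μ := by
  obtain ⟨Λ, hΛm, hΛK, hΛμ, hcl⟩ := h
  refine ⟨Λ, hΛm, hΛK, hΛμ, fun ℓ => ⟨1 / 2, 1, 0, 1, 2, by norm_num, by norm_num, le_rfl, le_rfl,
    by simp, one_pos, two_pos, fun d hd => ?_⟩⟩
  obtain ⟨δ, hδ, hret⟩ := hcl ℓ d hd
  refine ⟨δ, hδ, fun x hx n hn hnx hdist => ?_⟩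
  obtain ⟨z, hzK, T, hT, hTn, hfix, hsh⟩ := hret x hx n hn hnx hdist
  -- a jump vector of norm `d` (or the degenerate case of a trivial space)
  obtain ⟨e, he, he'⟩ : ∃ e : Hsp, ‖e‖ ≤ d ∧ (‖e‖ = d ∨ Subsingleton Hsp) := by
    rcases subsingleton_or_nontrivial Hsp with hs | hs
    · exact ⟨0, by simpa using hd.le, Or.inr hs⟩
    · obtain ⟨w, hw⟩ := exists_ne (0 : Hsp)
      have hw' : ‖w‖ ≠ 0 := norm_ne_zero_iff.2 hw
      have hnorm : ‖(d / ‖w‖) • w‖ = d := by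
        rw [norm_smul, Real.norm_of_nonneg (div_nonneg hd.le (norm_nonneg _)), div_mul_cancel₀ _ hw']
      exact ⟨(d / ‖w‖) • w, hnorm.le, Or.inl hnorm⟩
  refine ⟨fakeA, fakeP, fakeB, fakeψ n e, fake_isHyperbolicSequence, ?_, ?_, ?_, fun k => rfl,
    fakeψ_periodic n e, fun k => by simpa [fakeψ] using fakeJump_norm_le he k,
    sum_norm_fakeψ_zero_le hn he, ?_⟩
  · -- unstable invariance (trivial)
    intro k v hv
    rw [eq_zero_of_mem_unstable_fakeP hv, map_zero]
    exact Submodule.zero_mem _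
  · -- unstable expansion (trivial)
    intro k v hv
    rw [eq_zero_of_mem_unstable_fakeP hv, norm_zero]
    positivity
  · -- the nonlinearity is constant in `v`
    intro k v v' _ _
    rw [fakeψ_sub_fakeA, fakeψ_sub_fakeA, sub_self, norm_zero, zero_mul]
  · -- DECODE
    intro v σ _ htraj hvper hsum
    have hsum0 : 0 ≤ ∑ k ∈ Finset.range n, ‖v k‖ := Finset.sum_nonneg fun _ _ => norm_nonneg _
    have hσ : 0 ≤ σ := hsum0.trans hsum
    have h2σ : (0 : ℝ) ≤ 2 * σ := by linarith
    rcases he' with hed | hs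
    · have hdσ : d ≤ 2 * σ := by
        have := norm_jump_le_of_trajectory hn htraj hvper
        rw [hed] at this
        linarith
      exact ⟨z, hzK, T, hT, hTn.trans hdσ, hfix, fun k hk => (hsh k hk).trans hdσ⟩
    · -- degenerate case: a one-point space, every point is periodic
      refine ⟨x, hΛK ℓ hx, n, by exact_mod_cast hn, ?_, Subsingleton.elim _ _, fun k _ => ?_⟩
      · rw [sub_self, abs_zero]; exact h2σ
      · rw [dist_self]; exact h2σ

/-- **Equivalence of the registered encoding predicate with the closing property.** [folklore] -/
theorem hasPeriodicChartEncoding_iff_hasKatokClosing {K : Set Hsp} {φ : ℝ → Hsp → Hsp} {μ : Measure Hsp} :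
    HasPeriodicChartEncoding K φ μ ↔ HasKatokClosing K φ μ :=
  ⟨hasKatokClosing_of_encoding, hasPeriodicChartEncoding_of_hasKatokClosing⟩

/-- **Stub E of the line `ergodic-budget-selection-closing` (registered name)**: the closing property implies the periodic chart
encoding. [folklore] -/
theorem stub_encodingOfClosing {K : Set Hsp} {φ : ℝ → Hsp → Hsp} {μ : Measure Hsp} (h : HasKatokClosing K φ μ) :
    HasPeriodicChartEncoding K φ μ :=
  hasPeriodicChartEncoding_of_hasKatokClosing h

end Summit.AnomalousDissipation.AnomalousDissipation.Theorems.DenseLoudDesignerForces.Ergodic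

end
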